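import Summits.CriticalPhenomena.PercolationContinuityZ3.Theorems.PercNearOneGluingNoHeavyLowerTailSahiOneStepSharedBitCollapse
import Summits.CriticalPhenomena.PercolationContinuityZ3.Theorems.PercNearOneGluingNoHeavyLowerTailSahiOneStepDisjointSupport
import Summits.CriticalPhenomena.PercolationContinuityZ3.Theorems.PercNearOneGluingNoHeavyLowerTailSahiOneStepUniformMonoAPrelim
import HarnessLib

/-!
# One-step scheme: `(2′)` — and Kahn C5 / Sahi `C₃` — for increasing events SHARING AT MOST ONE COORDINATE, every density

Prover prim-ineq-prove-3 gen 26 (`--supports stmt-CriticalPhenomena-4575`; memo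
`run/shared/lean/prim/prim-ineq-prove-3/FINDING-G26-ONE-SHARED-COORDINATE.md`, THEOREM 1).  No definitions, no named facts, no sorries,
no `native_decide`.

The `(2′)` half of the one-step scheme, `Cov(A,B) ≥ μ(N_F < t)·Cov(A,B ∣ N_F < t)` (`0 ≤ osN`), was known for every density vector only
for DISJOINTLY supported pairs (`osN_disjoint_nonneg`, gen 25) and for literal steps; here it is proved for all pairs of increasing events
whose supports intersect in AT MOST ONE coordinate (`osN_oneShared_nonneg`, `osN_sharedOne_nonneg`), hence Kahn's Conjecture 5 / Sahi's
`C₃` `0 ≤ E₃(1_{N_F ≥ t}, 1_A, 1_B)` for every Hamming-threshold first slot and all such pairs (`sahiE3_threshold_sharedOne_nonneg`).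
Route: section at the shared coordinate `e`; on the cells of the blocks `P = (F∖e) ∩ S_A`, `R = (F∖e) ∖ P` both sections factor, the
cell masses are cross-monotone (layer monotonicity) and the layer laws are log-concave (`real_layer_logConcave`); the resulting grid
inequality is the THREE-CHAIN COLLAPSE LEMMA WITH ONE SHARED BIT (`ThreeChain.collapse_nonneg`), whose proof is elementary (condition on
a private chain, window restriction, Lagrange identity, Efron's two-variable monotonicity, law of total variance).
-/

noncomputable section

namespace Summit.CriticalPhenomena.PercolationContinuityZ3.Theorems

namespace SahiOneStep

section Cube

variable {ι : Type*} [Fintype ι] [DecidableEq ι]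

open MeasureTheory Finset
open Literature.Probability.Percolation (DeterminedBy determinedBy_iff determinedBy_univ)
open Literature.Probability.LatticeModels (prodBernoulli sahiE3 prodBernoulli_real_inter_of_determinedBy_disjoint)
open Literature.Probability.Percolation.DecisionTree (ind ind_of_mem ind_of_not_mem ind_nonneg)
open SahiE3Sections (determinedBy_section_insert determinedBy_section_sdiff)
open scoped Classical

omit [Fintype ι] in
/-- Counting the block through an inserted coordinate: for `e ∈ F`, `#(F ∩ insert e ω) = #((F.erase e) ∩ ω) + 1`. [folklore] -/
theorem card_filter_mem_insert (F : Finset ι) {e : ι} (he : e ∈ F) (ω : Set ι) {hd : DecidablePred (· ∈ insert e ω)}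
    [DecidablePred (· ∈ ω)] :
    (@Finset.filter ι (· ∈ insert e ω) hd F).card = ((F.erase e).filter (· ∈ ω)).card + 1 := by
  conv_lhs => rw [← Finset.insert_erase he]
  rw [Finset.filter_insert, if_pos (Set.mem_insert e ω)]
  have hfe : @Finset.filter ι (· ∈ insert e ω) hd (F.erase e) = (F.erase e).filter (· ∈ ω) :=
    Finset.filter_congr fun i hi => by
      have hie : i ≠ e := (Finset.mem_erase.1 hi).1
      simp [Set.mem_insert_iff, hie]
  rw [hfe, Finset.card_insert_of_notMem]
  intro h
  exact (Finset.mem_erase.1 (Finset.mem_filter.1 h).1).1 rfl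

omit [Fintype ι] in
/-- Counting the block through a deleted coordinate: `#(F ∩ (ω ∖ {e})) = #((F.erase e) ∩ ω)`. [folklore] -/
theorem card_filter_mem_sdiff (F : Finset ι) (e : ι) (ω : Set ι) {hd : DecidablePred (· ∈ ω \ {e})} [DecidablePred (· ∈ ω)] :
    (@Finset.filter ι (· ∈ ω \ {e}) hd F).card = ((F.erase e).filter (· ∈ ω)).card := by
  congr 1
  ext i
  simp only [Finset.mem_filter, Finset.mem_erase, Set.mem_sdiff, Set.mem_singleton_iff]
  tauto

/-- **`(2′)` FOR INCREASING EVENTS SHARING AT MOST ONE COORDINATE OF THE BLOCK.**  For every product measure, every block `F`,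
every `t`, and all increasing events `A`, `B` determined by finite coordinate sets `SA`, `SB` with `SA ∩ SB ⊆ {e}` for some
`e ∈ F`: `0 ≤ n(1_A, 1_B)` for the first slot `H = {N_F ≥ t}`, i.e. `Cov(A,B) ≥ μ(Hᶜ)·Cov(A,B ∣ Hᶜ)` (memo THEOREM 1).  Proof:
section at `e`, decompose the two sections over the cells of the blocks `P = (F∖e) ∩ SA` and `R = (F∖e) ∖ P` (on a cell the
events factor and the layer masses are cross-monotone by layer monotonicity, log-concave layer laws), and apply the three-chain
collapse lemma `ThreeChain.collapse_nonneg`. [this work] -/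
theorem osN_oneShared_nonneg (p : ι → unitInterval) (F : Finset ι) (t : ℕ) {A B : Set (Set ι)}
    (hA : IsUpperSet A) (hB : IsUpperSet B) {SA SB : Finset ι} (hAS : DeterminedBy A (↑SA : Set ι))
    (hBS : DeterminedBy B (↑SB : Set ι)) {e : ι} (he : e ∈ F) (hI : SA ∩ SB ⊆ {e}) :
    0 ≤ osN p {ω : Set ι | t ≤ (F.filter (· ∈ ω)).card} (ind A) (ind B) := by
  -- blocks
  set F' : Finset ι := F.erase e with hF'
  set P : Finset ι := F'.filter (· ∈ SA) with hP
  set R : Finset ι := F' \ P with hR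
  have hPF' : P ⊆ F' := Finset.filter_subset _ _
  have hPR : Disjoint P R := Finset.disjoint_sdiff
  set SA' : Finset ι := SA.erase e with hSA'
  set SB' : Finset ι := SB.erase e with hSB'
  have hSAB : Disjoint SA' SB' := by
    rw [Finset.disjoint_left]
    intro i hiA hiB
    have hi : i ∈ SA ∩ SB := Finset.mem_inter.2 ⟨(Finset.mem_erase.1 hiA).2, (Finset.mem_erase.1 hiB).2⟩
    exact (Finset.mem_erase.1 hiA).1 (Finset.mem_singleton.1 (hI hi))
  have hPSA' : P ⊆ SA' := fun i hi => by
    have h := Finset.mem_filter.1 hi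
    exact Finset.mem_erase.2 ⟨(Finset.mem_erase.1 h.1).1, h.2⟩
  have hSA'R : Disjoint SA' R := by
    rw [Finset.disjoint_left]
    intro i hiA hiR
    have h := Finset.mem_sdiff.1 hiR
    exact h.2 (Finset.mem_filter.2 ⟨h.1, (Finset.mem_erase.1 hiA).2⟩)
  have hdisjA : Disjoint SA' (SB' ∪ R) := Finset.disjoint_union_right.2 ⟨hSAB, hSA'R⟩
  have hdisjP : Disjoint P (SB' ∪ R) :=
    Finset.disjoint_union_right.2 ⟨Finset.disjoint_of_subset_left hPSA' hSAB, hPR⟩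
  -- sections at `e`
  set Az : ℕ → Set (Set ι) := fun z => if z = 1 then {ω : Set ι | insert e ω ∈ A} else {ω : Set ι | ω \ {e} ∈ A} with hAz
  set Bz : ℕ → Set (Set ι) := fun z => if z = 1 then {ω : Set ι | insert e ω ∈ B} else {ω : Set ι | ω \ {e} ∈ B} with hBz
  have hcoeA : (↑SA' : Set ι) = (↑SA : Set ι) \ {e} := by rw [hSA', Finset.coe_erase]
  have hcoeB : (↑SB' : Set ι) = (↑SB : Set ι) \ {e} := by rw [hSB', Finset.coe_erase]
  have hAz_up : ∀ z, IsUpperSet (Az z) := fun z => by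
    simp only [hAz]; split_ifs; exacts [isUpperSet_section_insert hA e, isUpperSet_section_sdiff hA e]
  have hBz_up : ∀ z, IsUpperSet (Bz z) := fun z => by
    simp only [hBz]; split_ifs; exacts [isUpperSet_section_insert hB e, isUpperSet_section_sdiff hB e]
  have hAz_det : ∀ z, DeterminedBy (Az z) (↑SA' : Set ι) := fun z => by
    rw [hcoeA]; simp only [hAz]; split_ifs; exacts [determinedBy_section_insert hAS e, determinedBy_section_sdiff hAS e]
  have hBz_det : ∀ z, DeterminedBy (Bz z) (↑SB' : Set ι) := fun z => by
    rw [hcoeB]; simp only [hBz]; split_ifs; exacts [determinedBy_section_insert hBS e, determinedBy_section_sdiff hBS e]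
  have hAz_mono : Az 0 ⊆ Az 1 := by
    simp only [hAz, show ((0:ℕ) = 1) = False from by simp, if_false, if_true]
    exact section_sdiff_subset_section_insert hA e
  have hBz_mono : Bz 0 ⊆ Bz 1 := by
    simp only [hBz, show ((0:ℕ) = 1) = False from by simp, if_false, if_true]
    exact section_sdiff_subset_section_insert hB e
  -- grid data
  obtain ⟨a, ha⟩ : ∃ a : ℕ → ℝ, ∀ k, a k = (prodBernoulli p).real {ω' : Set ι | (P.filter (· ∈ ω')).card = k} := ⟨_, fun _ => rfl⟩
  obtain ⟨b, hb⟩ : ∃ b : ℕ → ℝ, ∀ j, b j = (prodBernoulli p).real {ω' : Set ι | (R.filter (· ∈ ω')).card = j} := ⟨_, fun _ => rfl⟩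
  obtain ⟨α, hα⟩ : ∃ α : ℕ → ℕ → ℝ, ∀ z k, α z k = (prodBernoulli p).real (Az z ∩ {ω' : Set ι | (P.filter (· ∈ ω')).card = k}) :=
    ⟨_, fun _ _ => rfl⟩
  obtain ⟨β, hβ⟩ : ∃ β : ℕ → ℕ → ℝ, ∀ z j, β z j = (prodBernoulli p).real (Bz z ∩ {ω' : Set ι | (R.filter (· ∈ ω')).card = j}) :=
    ⟨_, fun _ _ => rfl⟩
  obtain ⟨c, hc⟩ : ∃ c : ℕ → ℝ, ∀ z, c z = if z = 1 then (p e : ℝ) else 1 - p e := ⟨_, fun _ => rfl⟩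
  have hpe0 : 0 ≤ (p e : ℝ) := (p e).2.1
  have hpe1 : (p e : ℝ) ≤ 1 := (p e).2.2
  have hc0 : ∀ z, 0 ≤ c z := fun z => by rw [hc]; split_ifs; exacts [hpe0, sub_nonneg.2 hpe1]
  have hc1 : c 0 + c 1 = 1 := by rw [hc, hc]; simp
  have ha0 : ∀ k, 0 ≤ a k := fun k => by rw [ha]; exact measureReal_nonneg
  have hb0 : ∀ j, 0 ≤ b j := fun j => by rw [hb]; exact measureReal_nonneg
  have haK : ∀ k, P.card < k → a k = 0 := fun k hk => by
    rw [ha]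
    have : {ω' : Set ι | (P.filter (· ∈ ω')).card = k} = ∅ := by
      ext ω; simp only [Set.mem_setOf_eq, Set.mem_empty_iff_false, iff_false]
      intro h; have := Finset.card_filter_le P (· ∈ ω); omega
    rw [this, measureReal_empty]
  have hbJ : ∀ j, R.card < j → b j = 0 := fun j hj => by
    rw [hb]
    have : {ω' : Set ι | (R.filter (· ∈ ω')).card = j} = ∅ := by
      ext ω; simp only [Set.mem_setOf_eq, Set.mem_empty_iff_false, iff_false]
      intro h; have := Finset.card_filter_le R (· ∈ ω); omega
    rw [this, measureReal_empty]
  have halc : ∀ i j, i < j → a i * a (j + 1) ≤ a (i + 1) * a j := fun i j hij => by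
    rw [ha, ha, ha, ha]; exact real_layer_logConcave p P hij
  have hblc : ∀ i j, i < j → b i * b (j + 1) ≤ b (i + 1) * b j := fun i j hij => by
    rw [hb, hb, hb, hb]; exact real_layer_logConcave p R hij
  have hα0 : ∀ z k, 0 ≤ α z k := fun z k => by rw [hα]; exact measureReal_nonneg
  have hβ0 : ∀ z j, 0 ≤ β z j := fun z j => by rw [hβ]; exact measureReal_nonneg
  have hαa : ∀ z k, α z k ≤ a k := fun z k => by rw [hα, ha]; exact measureReal_mono Set.inter_subset_right
  have hβb : ∀ z j, β z j ≤ b j := fun z j => by rw [hβ, hb]; exact measureReal_mono Set.inter_subset_right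
  have hαz : ∀ k, α 0 k ≤ α 1 k := fun k => by
    rw [hα, hα]; exact measureReal_mono (Set.inter_subset_inter_left _ hAz_mono)
  have hβz : ∀ j, β 0 j ≤ β 1 j := fun j => by
    rw [hβ, hβ]; exact measureReal_mono (Set.inter_subset_inter_left _ hBz_mono)
  have hαk : ∀ z k k', k ≤ k' → α z k * a k' ≤ α z k' * a k := fun z k k' hkk' => by
    have h := real_inter_inter_layer_mul_le p P (hAz_up z) (determinedBy_univ ((↑P : Set ι)ᶜ)) hkk'
    rw [Set.inter_univ] at h
    rw [hα, hα, ha, ha]; exact h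
  have hβj : ∀ z j j', j ≤ j' → β z j * b j' ≤ β z j' * b j := fun z j j' hjj' => by
    have h := real_inter_inter_layer_mul_le p R (hBz_up z) (determinedBy_univ ((↑R : Set ι)ᶜ)) hjj'
    rw [Set.inter_univ] at h
    rw [hβ, hβ, hb, hb]; exact h
  have key := ThreeChain.collapse_nonneg P.card R.card t c a b α β hc0 hc1 ha0 haK halc hb0 hbJ hblc
    hα0 hαa hαz hαk hβ0 hβb hβz hβj
  -- normalisations
  have hA1 : ∑ k ∈ range (P.card + 1), a k = 1 := by
    rw [Finset.sum_congr rfl fun k _ => ha k]; exact sum_real_layer_eq_one p P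
  have hB1 : ∑ j ∈ range (R.card + 1), b j = 1 := by
    rw [Finset.sum_congr rfl fun j _ => hb j]; exact sum_real_layer_eq_one p R
  have hab1 : (∑ k ∈ range (P.card + 1), ∑ j ∈ range (R.card + 1), a k * b j) = 1 := by
    rw [← Finset.sum_mul_sum, hA1, hB1, mul_one]
  -- the sections of `H`
  set Hz : ℕ → Set (Set ι) := fun z => {ω : Set ι | t ≤ z + (F'.filter (· ∈ ω)).card} with hHz
  set H : Set (Set ι) := {ω : Set ι | t ≤ (F.filter (· ∈ ω)).card} with hH
  have sec1 : ∀ X : Set (Set ι), {ω : Set ι | insert e ω ∈ H ∩ X} = Hz 1 ∩ {ω : Set ι | insert e ω ∈ X} := by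
    intro X; ext ω
    simp only [hH, hHz, Set.mem_setOf_eq, Set.mem_inter_iff]
    rw [card_filter_mem_insert F he ω, ← hF']
    constructor
    · rintro ⟨h1, h2⟩; exact ⟨by omega, h2⟩
    · rintro ⟨h1, h2⟩; exact ⟨by omega, h2⟩
  have sec0 : ∀ X : Set (Set ι), {ω : Set ι | ω \ {e} ∈ H ∩ X} = Hz 0 ∩ {ω : Set ι | ω \ {e} ∈ X} := by
    intro X; ext ω
    simp only [hH, hHz, Set.mem_setOf_eq, Set.mem_inter_iff]
    rw [card_filter_mem_sdiff F e ω, ← hF', zero_add]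
  have hAz1 : Az 1 = {ω : Set ι | insert e ω ∈ A} := by simp [hAz]
  have hAz0 : Az 0 = {ω : Set ι | ω \ {e} ∈ A} := by simp [hAz]
  have hBz1 : Bz 1 = {ω : Set ι | insert e ω ∈ B} := by simp [hBz]
  have hBz0 : Bz 0 = {ω : Set ι | ω \ {e} ∈ B} := by simp [hBz]
  -- membership in `Hz z` on a cell
  have memH : ∀ (z : ℕ) (ω : Set ι) (k j : ℕ), (P.filter (· ∈ ω)).card = k → (R.filter (· ∈ ω)).card = j →
      (ω ∈ Hz z ↔ t ≤ z + k + j) := by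
    intro z ω k j hk hj
    simp only [hHz, Set.mem_setOf_eq]
    rw [card_filter_mem_eq_add F' hPF' ω, hk, ← hR, hj, add_assoc]
  -- supports of the cell events
  have hAk : ∀ z k, DeterminedBy (Az z ∩ {ω' : Set ι | (P.filter (· ∈ ω')).card = k}) (↑SA' : Set ι) := fun z k =>
    (hAz_det z).inter ((determinedBy_layer P k).mono (Finset.coe_subset.2 hPSA'))
  have hBjR : ∀ z j, DeterminedBy (Bz z ∩ {ω' : Set ι | (R.filter (· ∈ ω')).card = j}) (↑(SB' ∪ R) : Set ι) := fun z j => by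
    rw [Finset.coe_union]
    exact ((hBz_det z).mono Set.subset_union_left).inter ((determinedBy_layer R j).mono Set.subset_union_right)
  have hRj : ∀ j, DeterminedBy {ω' : Set ι | (R.filter (· ∈ ω')).card = j} (↑(SB' ∪ R) : Set ι) := fun j => by
    rw [Finset.coe_union]; exact (determinedBy_layer R j).mono Set.subset_union_right
  -- the four cell products
  have cAB : ∀ z k j, (prodBernoulli p).real ((Az z ∩ Bz z) ∩ {ω' : Set ι | (R.filter (· ∈ ω')).card = j} ∩
      {ω' : Set ι | (P.filter (· ∈ ω')).card = k}) = α z k * β z j := fun z k j => by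
    have hset : (Az z ∩ Bz z) ∩ {ω' : Set ι | (R.filter (· ∈ ω')).card = j} ∩ {ω' : Set ι | (P.filter (· ∈ ω')).card = k} =
        (Az z ∩ {ω' : Set ι | (P.filter (· ∈ ω')).card = k}) ∩ (Bz z ∩ {ω' : Set ι | (R.filter (· ∈ ω')).card = j}) := by
      ext ω; simp only [Set.mem_inter_iff, Set.mem_setOf_eq]; tauto
    rw [hset, hα, hβ]
    exact prodBernoulli_real_inter_of_determinedBy_disjoint p hdisjA (hAk z k) (hBjR z j)
      MeasurableSet.of_discrete MeasurableSet.of_discrete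
  have cA : ∀ z k j, (prodBernoulli p).real (Az z ∩ {ω' : Set ι | (R.filter (· ∈ ω')).card = j} ∩
      {ω' : Set ι | (P.filter (· ∈ ω')).card = k}) = α z k * b j := fun z k j => by
    have hset : Az z ∩ {ω' : Set ι | (R.filter (· ∈ ω')).card = j} ∩ {ω' : Set ι | (P.filter (· ∈ ω')).card = k} =
        (Az z ∩ {ω' : Set ι | (P.filter (· ∈ ω')).card = k}) ∩ {ω' : Set ι | (R.filter (· ∈ ω')).card = j} := by
      ext ω; simp only [Set.mem_inter_iff, Set.mem_setOf_eq]; tauto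
    rw [hset, hα, hb]
    exact prodBernoulli_real_inter_of_determinedBy_disjoint p hdisjA (hAk z k) (hRj j)
      MeasurableSet.of_discrete MeasurableSet.of_discrete
  have cB : ∀ z k j, (prodBernoulli p).real (Bz z ∩ {ω' : Set ι | (R.filter (· ∈ ω')).card = j} ∩
      {ω' : Set ι | (P.filter (· ∈ ω')).card = k}) = a k * β z j := fun z k j => by
    have hset : Bz z ∩ {ω' : Set ι | (R.filter (· ∈ ω')).card = j} ∩ {ω' : Set ι | (P.filter (· ∈ ω')).card = k} =
        {ω' : Set ι | (P.filter (· ∈ ω')).card = k} ∩ (Bz z ∩ {ω' : Set ι | (R.filter (· ∈ ω')).card = j}) := by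
      ext ω; simp only [Set.mem_inter_iff, Set.mem_setOf_eq]; tauto
    rw [hset, ha, hβ]
    exact prodBernoulli_real_inter_of_determinedBy_disjoint p hdisjP (determinedBy_layer P k) (hBjR z j)
      MeasurableSet.of_discrete MeasurableSet.of_discrete
  have cU : ∀ k j, (prodBernoulli p).real (Set.univ ∩ {ω' : Set ι | (R.filter (· ∈ ω')).card = j} ∩
      {ω' : Set ι | (P.filter (· ∈ ω')).card = k}) = a k * b j := fun k j => by
    rw [ha, hb]; exact real_cell_eq_mul p hPR k j
  -- the section measures as grid sums
  have eHAB : ∀ z, (prodBernoulli p).real (Hz z ∩ (Az z ∩ Bz z)) = ∑ k ∈ range (P.card + 1), ∑ j ∈ range (R.card + 1),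
      if t ≤ z + k + j then α z k * β z j else 0 := fun z => by
    rw [real_eq_sum_cells p P R]
    refine Finset.sum_congr rfl fun k _ => Finset.sum_congr rfl fun j _ => ?_
    rw [← cAB]
    exact real_inter_cell_eq_ite p P R (C := Hz z ∩ (Az z ∩ Bz z)) (V := Az z ∩ Bz z) (P := t ≤ z + k + j) fun ω hk hj => by
      rw [Set.mem_inter_iff, memH z ω k j hk hj]
  have eHA : ∀ z, (prodBernoulli p).real (Hz z ∩ Az z) = ∑ k ∈ range (P.card + 1), ∑ j ∈ range (R.card + 1),
      if t ≤ z + k + j then α z k * b j else 0 := fun z => by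
    rw [real_eq_sum_cells p P R]
    refine Finset.sum_congr rfl fun k _ => Finset.sum_congr rfl fun j _ => ?_
    rw [← cA]
    exact real_inter_cell_eq_ite p P R (C := Hz z ∩ Az z) (V := Az z) (P := t ≤ z + k + j) fun ω hk hj => by
      rw [Set.mem_inter_iff, memH z ω k j hk hj]
  have eHB : ∀ z, (prodBernoulli p).real (Hz z ∩ Bz z) = ∑ k ∈ range (P.card + 1), ∑ j ∈ range (R.card + 1),
      if t ≤ z + k + j then a k * β z j else 0 := fun z => by
    rw [real_eq_sum_cells p P R]
    refine Finset.sum_congr rfl fun k _ => Finset.sum_congr rfl fun j _ => ?_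
    rw [← cB]
    exact real_inter_cell_eq_ite p P R (C := Hz z ∩ Bz z) (V := Bz z) (P := t ≤ z + k + j) fun ω hk hj => by
      rw [Set.mem_inter_iff, memH z ω k j hk hj]
  have eH : ∀ z, (prodBernoulli p).real (Hz z) = ∑ k ∈ range (P.card + 1), ∑ j ∈ range (R.card + 1),
      if t ≤ z + k + j then a k * b j else 0 := fun z => by
    rw [real_eq_sum_cells p P R]
    refine Finset.sum_congr rfl fun k _ => Finset.sum_congr rfl fun j _ => ?_
    rw [← cU]
    exact real_inter_cell_eq_ite p P R (C := Hz z) (V := Set.univ) (P := t ≤ z + k + j) fun ω hk hj => by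
      rw [memH z ω k j hk hj]; simp
  have eA : ∀ z, (prodBernoulli p).real (Az z) = ∑ k ∈ range (P.card + 1), α z k := fun z => by
    rw [real_eq_sum_cells p P R]
    refine Finset.sum_congr rfl fun k _ => ?_
    rw [Finset.sum_congr rfl fun j _ => cA z k j, ← Finset.mul_sum, hB1, mul_one]
  have eB : ∀ z, (prodBernoulli p).real (Bz z) = ∑ j ∈ range (R.card + 1), β z j := fun z => by
    rw [real_eq_sum_cells p P R]
    rw [Finset.sum_congr rfl fun k _ => Finset.sum_congr rfl fun j _ => cB z k j]
    rw [Finset.sum_comm]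
    refine Finset.sum_congr rfl fun j _ => ?_
    rw [Finset.sum_congr rfl fun k _ => (mul_comm (a k) (β z j)), ← Finset.mul_sum, hA1, mul_one]
  -- splitting at `e`
  have mHAB : (prodBernoulli p).real (H ∩ A ∩ B) =
      (p e : ℝ) * (prodBernoulli p).real (Hz 1 ∩ (Az 1 ∩ Bz 1)) + (1 - p e) * (prodBernoulli p).real (Hz 0 ∩ (Az 0 ∩ Bz 0)) := by
    rw [Set.inter_assoc, real_split p e (H ∩ (A ∩ B)), sec1, sec0, section_insert_inter, section_sdiff_inter, hAz1, hAz0, hBz1, hBz0]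
  have mHA : (prodBernoulli p).real (H ∩ A) =
      (p e : ℝ) * (prodBernoulli p).real (Hz 1 ∩ Az 1) + (1 - p e) * (prodBernoulli p).real (Hz 0 ∩ Az 0) := by
    rw [real_split p e (H ∩ A), sec1, sec0, hAz1, hAz0]
  have mHB : (prodBernoulli p).real (H ∩ B) =
      (p e : ℝ) * (prodBernoulli p).real (Hz 1 ∩ Bz 1) + (1 - p e) * (prodBernoulli p).real (Hz 0 ∩ Bz 0) := by
    rw [real_split p e (H ∩ B), sec1, sec0, hBz1, hBz0]
  have mH : (prodBernoulli p).real H = (p e : ℝ) * (prodBernoulli p).real (Hz 1) + (1 - p e) * (prodBernoulli p).real (Hz 0) := by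
    have h1 := sec1 Set.univ
    have h0 := sec0 Set.univ
    simp only [Set.inter_univ, Set.mem_univ, Set.setOf_true] at h1 h0
    rw [real_split p e H, h1, h0]
  have mA : (prodBernoulli p).real A = (p e : ℝ) * (prodBernoulli p).real (Az 1) + (1 - p e) * (prodBernoulli p).real (Az 0) := by
    rw [real_split p e A, hAz1, hAz0]
  have mB : (prodBernoulli p).real B = (p e : ℝ) * (prodBernoulli p).real (Bz 1) + (1 - p e) * (prodBernoulli p).real (Bz 0) := by
    rw [real_split p e B, hBz1, hBz0]
  -- conversion of the triple sums of `key`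
  have c0 : c 0 = 1 - p e := by rw [hc]; simp
  have c1 : c 1 = p e := by rw [hc]; simp
  have convH : ∀ (z : ℕ) (u v : ℕ → ℝ), (∑ k ∈ range (P.card + 1), ∑ j ∈ range (R.card + 1),
      if z + k + j < t then 0 else c z * u k * v j) =
      c z * ∑ k ∈ range (P.card + 1), ∑ j ∈ range (R.card + 1), if t ≤ z + k + j then u k * v j else 0 := by
    intro z u v
    rw [Finset.mul_sum]
    refine Finset.sum_congr rfl fun k _ => ?_
    rw [Finset.mul_sum]
    refine Finset.sum_congr rfl fun j _ => ?_
    by_cases h : z + k + j < t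
    · rw [if_pos h, if_neg (by omega), mul_zero]
    · rw [if_neg h, if_pos (by omega), mul_assoc]
  have convL : ∀ (z : ℕ) (u v : ℕ → ℝ), (∑ k ∈ range (P.card + 1), ∑ j ∈ range (R.card + 1),
      if z + k + j < t then c z * u k * v j else 0) =
      c z * (∑ k ∈ range (P.card + 1), ∑ j ∈ range (R.card + 1), u k * v j) -
        c z * ∑ k ∈ range (P.card + 1), ∑ j ∈ range (R.card + 1), if t ≤ z + k + j then u k * v j else 0 := by
    intro z u v
    rw [Finset.mul_sum, Finset.mul_sum, ← Finset.sum_sub_distrib]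
    refine Finset.sum_congr rfl fun k _ => ?_
    rw [Finset.mul_sum, Finset.mul_sum, ← Finset.sum_sub_distrib]
    refine Finset.sum_congr rfl fun j _ => ?_
    by_cases h : z + k + j < t
    · rw [if_pos h, if_neg (by omega)]; ring
    · rw [if_neg h, if_pos (by omega)]; ring
  have prodA : ∀ z, (∑ k ∈ range (P.card + 1), ∑ j ∈ range (R.card + 1), α z k * b j) = ∑ k ∈ range (P.card + 1), α z k := by
    intro z; rw [← Finset.sum_mul_sum, hB1, mul_one]
  have prodB : ∀ z, (∑ k ∈ range (P.card + 1), ∑ j ∈ range (R.card + 1), a k * β z j) = ∑ j ∈ range (R.card + 1), β z j := by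
    intro z; rw [← Finset.sum_mul_sum, hA1, one_mul]
  have sA : ∀ z, (∑ k ∈ range (P.card + 1), c z * α z k) = c z * ∑ k ∈ range (P.card + 1), α z k := fun z => by
    rw [Finset.mul_sum]
  have sB : ∀ z, (∑ j ∈ range (R.card + 1), c z * β z j) = c z * ∑ j ∈ range (R.card + 1), β z j := fun z => by
    rw [Finset.mul_sum]
  -- rewrite `key`
  rw [ThreeChain.sum_range_two, ThreeChain.sum_range_two, ThreeChain.sum_range_two, ThreeChain.sum_range_two,
    ThreeChain.sum_range_two, ThreeChain.sum_range_two] at key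
  rw [convL 0 a b, convL 1 a b, convH 0 (α 0) (β 0), convH 1 (α 1) (β 1), convL 0 (α 0) b, convL 1 (α 1) b,
    convL 0 a (β 0), convL 1 a (β 1), sA 0, sA 1, sB 0, sB 1, hab1, prodA 0, prodA 1, prodB 0, prodB 1, c0, c1] at key
  -- rewrite the goal
  rw [osN_ind_ind, mHA, mHB, mH, mHAB, mA, mB, eHAB 1, eHAB 0, eHA 1, eHA 0, eHB 1, eHB 0, eH 1, eH 0, eA 1, eA 0, eB 1, eB 0]
  refine key.trans_eq ?_
  ring

/-- **KAHN C5 / SAHI `C₃` FOR A HAMMING THRESHOLD AND TWO INCREASING EVENTS SHARING AT MOST ONE COORDINATE OF THE BLOCK.**  For every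
product measure, every block `F`, every `t`, and all increasing `A`, `B` determined by finite coordinate sets `SA`, `SB` with
`SA ∩ SB ⊆ {e}`, `e ∈ F`: `0 ≤ E₃(1_{N_F ≥ t}, 1_A, 1_B)` (memo THEOREM 1; Q-HARRIS `osMp_threshold_nonneg_all` + `osN_oneShared_nonneg`).
[this work] -/
theorem sahiE3_threshold_oneShared_nonneg (p : ι → unitInterval) (F : Finset ι) (t : ℕ) {A B : Set (Set ι)}
    (hA : IsUpperSet A) (hB : IsUpperSet B) {SA SB : Finset ι} (hAS : DeterminedBy A (↑SA : Set ι))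
    (hBS : DeterminedBy B (↑SB : Set ι)) {e : ι} (he : e ∈ F) (hI : SA ∩ SB ⊆ {e}) :
    0 ≤ sahiE3 (prodBernoulli p) {ω : Set ι | t ≤ (F.filter (· ∈ ω)).card} A B := by
  rw [← osT_ind_ind, osT_eq_osMp_add_osN]
  exact add_nonneg (osMp_threshold_nonneg_all p F t hA hB) (osN_oneShared_nonneg p F t hA hB hAS hBS he hI)


end Cube

end SahiOneStep

end Summit.CriticalPhenomena.PercolationContinuityZ3.Theorems
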